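import Literature.Probability.Percolation.CLE6InfiniteTraces
import Literature.Probability.RandomPlanarGeometry.FewLargeTraces
import Literature.Probability.Percolation.LoopCrossingArms
import Literature.Probability.Percolation.TriAnnulusCrossingProofs
import Mathlib.Combinatorics.Pigeonhole
import HarnessLib

/-!
# Scaling limits of the percolation loop collections are locally finite

Topic `Literature/Probability/Percolation`, companion to `CLE6.lean`. The unrooted Camia–Newman
statement `exists_isCNLFamily_tendsto` requires of the limit law the field
`IsCNLFamily.ae_finite_traces` (F. Camia, C. M. Newman, Comm. Math. Phys. 268 (2006), Thm 2 (ii):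
almost surely any bounded region meets only finitely many loops of diameter `> ε`; here: almost
surely, for every `ε > 0`, only finitely many distinct traces of diameter `> ε`). This file proves
it for **every subsequential limit** of the laws of `triLoopCollection D δ`:

* generic part (`RandomPlanarGeometry/FewLargeTraces.lean`): the event
  `LoopSpace.FewLargeTraces N ε` ("no `N + 1` members with pairwise distinct traces all of
  diameter `> ε`") is CLOSED and implies finiteness of the set of traces of diameter `> ε`;
* lattice part: if the loop collection at mesh `δ` is not in `FewLargeTraces N ε` with
  `N + 1 > M₀ (2j + 1)`, `M₀` the number of `ε/16`-balls covering `D̄₁ = cthickening 1 D`, then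
  `2j + 2` interface loops with pairwise distinct (hence disjoint) traces of diameter `> ε` meet one
  ball `B(x, ε/16)` and traverse `D(x; ε/16, ε/4)`, so that `ω` has `j` disjoint open arms
  across `A(x; ε/16 + 9δ, ε/4 - 9δ)` (`mem_disjointOccurrencePow_of_loops`,
  `LoopCrossingArms.lean`), an event of probability `≤ 3^{-α j}` by the BK inequality and the RSW
  annulus bound (`real_disjointOccurrencePow_le_pow`, `real_triArm_le`);
* limit: the closed-set portmanteau inequality for subsequential limits
  (`le_measure_of_isClosed_of_tendsto`) and `j → ∞` give `P'(⋃_N FewLargeTraces N ε) = 1` for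
  each `ε`, whence `ae_finite_traces_of_tendsto` and the reduction
  `exists_isCNLFamily_tendsto_of_tendstoLaw'''` of `exists_isCNLFamily_tendsto` to the existence
  of limit laws plus conformal invariance alone.

## References

* F. Camia, C. M. Newman, Comm. Math. Phys. 268 (2006), Thm 2 (ii) (= arXiv:math/0504036, Thm 3,
  property 2, and Thm 1, second part: all contours of diameter `> ε` in a bounded region are found
  in a bounded number of steps) [CamiaNewman2006].
* M. Aizenman, A. Burchard, Duke Math. J. 99 (1999), Appendix A [AizenmanBurchardDuke1999].
* P. Billingsley, *Convergence of probability measures*, 2nd ed. (1999), Thm 2.1 [Billingsley1999].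
-/

noncomputable section

open Set Filter Metric MeasureTheory
open scoped ENNReal NNReal Topology unitInterval

/-! ### Lattice part -/

namespace Literature.Probability.Percolation

open RandomPlanarGeometry LatticeModels

/-- The polygon of a walk of `ℍ` ends at the (scaled) centre of its last hexagon. [folklore] -/
theorem hexLoopCurve_apply_one {f₀ g₀ : HexVertex} (δ : ℝ) (w : hexGraph.Walk f₀ g₀) :
    hexLoopCurve δ w 1 = (δ : ℂ) * hexCenter g₀ := by
  rw [loopCurve_apply]
  unfold SimpleGraph.Walk.toCurve
  have h : ∀ (l : List ℂ) (hl : l ≠ []), polyline l 1 = l.getLast hl := by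
    intro l hl
    match l, hl with
    | a :: l, _ => exact polyline_apply_one a l
  rw [h _ (by simp), List.getLast_map, SimpleGraph.Walk.getLast_support]

/-- **A traversal from a positive time.** If the closed polygon `Γ = hexLoopCurve δ w`
(`Γ 0 = Γ 1`) visits `B̄(x, ρ)` and the exterior `{dist ≥ R}` (`ρ < R`), it traverses `D(x; ρ, R)`
on some parameter interval `[s, t]` with `0 < s`. [folklore] -/
theorem exists_pos_isTraversal {f₀ : HexVertex} (δ : ℝ) (w : hexGraph.Walk f₀ f₀) {x : ℂ} {ρ R : ℝ}
    (hρR : ρ < R) {u₁ u₂ : I} (h₁ : dist (hexLoopCurve δ w u₁) x ≤ ρ) (h₂ : R ≤ dist (hexLoopCurve δ w u₂) x) :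
    ∃ s t : I, 0 < (s : ℝ) ∧ (hexLoopCurve δ w).IsTraversal x ρ R s t := by
  have h01 : hexLoopCurve δ w 1 = hexLoopCurve δ w 0 := by
    rw [hexLoopCurve_apply_one, loopCurve_apply, SimpleGraph.Walk.toCurve_apply_zero]
  rcases le_or_gt u₁ u₂ with hle | hlt
  · rcases eq_or_lt_of_le (u₁.2.1 : (0 : ℝ) ≤ u₁) with h0 | h0
    · -- `u₁ = 0`: use the copy of the near point at time `1`
      have hu : u₁ = 0 := Subtype.ext h0.symm
      subst hu
      have hu₂ : 0 < (u₂ : ℝ) := by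
        rcases eq_or_lt_of_le (u₂.2.1 : (0 : ℝ) ≤ u₂) with h | h
        · exfalso
          have : u₂ = 0 := Subtype.ext h.symm
          subst this
          linarith
        · exact h
      refine ⟨u₂, 1, hu₂, unitInterval.le_one', Or.inr ⟨h₂, ?_⟩⟩
      rw [h01]; exact h₁
    · exact ⟨u₁, u₂, h0, hle, Or.inl ⟨h₁, h₂⟩⟩
  · rcases eq_or_lt_of_le (u₂.2.1 : (0 : ℝ) ≤ u₂) with h0 | h0
    · have hu : u₂ = 0 := Subtype.ext h0.symm
      subst hu
      have hu₁ : 0 < (u₁ : ℝ) := by exact_mod_cast hlt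
      refine ⟨u₁, 1, hu₁, unitInterval.le_one', Or.inl ⟨h₁, ?_⟩⟩
      rw [h01]; exact h₂
    · exact ⟨u₂, u₁, h0, hlt.le, Or.inr ⟨h₂, h₁⟩⟩

/-- **Many distinct large interface loops near a point force disjoint open arms.** If `2j + 2`
interface loops of `ω` at mesh `δ` have pairwise distinct traces, each of diameter `> ε` and each
meeting `B̄(x, ε/16)`, and `0 < δ ≤ 3ε/640`, then `ω ∈ (triArm δ x (ε/16 + 9δ) (ε/4 - 9δ))^{□ j}`
(distinct traces are disjoint, `polyTrace_eq_or_disjoint`; each polygon traverses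
`D(x; ε/16, ε/4)`; `mem_disjointOccurrencePow_of_loops`). [cite: AizenmanBurchardDuke1999, Appendix A] -/
theorem mem_disjointOccurrencePow_of_distinct_loops {ω : SiteConfig (Site 2)} {δ ε : ℝ} (hδ : 0 < δ)
    (hε : 0 < ε) (hδε : δ ≤ 3 * ε / 640) {x : ℂ} {j : ℕ}
    {f : Fin (2 * j + 2) → HexVertex} {w : ∀ l, hexGraph.Walk (f l) (f l)}
    (hw : ∀ l, IsSiteInterfaceLoop ω (w l))
    (hne : ∀ l l', l ≠ l' → polyTrace δ (w l) ≠ polyTrace δ (w l'))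
    (hdiam : ∀ l, ε < diam (polyTrace δ (w l)))
    (hmeet : ∀ l, ∃ z ∈ polyTrace δ (w l), dist z x ≤ ε / 16) :
    ω ∈ disjointOccurrencePow (triArm δ x (ε / 16 + 9 * δ) (ε / 4 - 9 * δ)) j := by
  have hlen : ∀ l, 0 < (w l).length := fun l ↦ by have := (hw l).three_le_length; omega
  refine mem_disjointOccurrencePow_of_loops hδ (ρ := ε / 16) (R := ε / 4) (by positivity) le_rfl
    (by linarith) le_rfl hw (fun l l' hll' ↦ ?_) (fun l ↦ ?_)
  · exact ((hw l).polyTrace_eq_or_disjoint hδ.ne' (hw l')).resolve_left (hne l l' hll')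
  · obtain ⟨z, hz, hzx⟩ := hmeet l
    -- a far point of the trace
    obtain ⟨z', hz', hz'x⟩ : ∃ z' ∈ polyTrace δ (w l), ε / 4 ≤ dist z' x := by
      by_contra h
      push Not at h
      have : diam (polyTrace δ (w l)) ≤ ε / 4 + ε / 4 := by
        refine diam_le_of_forall_dist_le (by positivity) fun a ha b hb ↦ ?_
        have := dist_triangle a x b
        rw [dist_comm x b] at this
        linarith [h a ha, h b hb]
      linarith [hdiam l]
    rw [← range_toCurve_eq_polyTrace (hlen l)] at hz hz'
    obtain ⟨u₁, rfl⟩ := hz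
    obtain ⟨u₂, rfl⟩ := hz'
    exact exists_pos_isTraversal δ (w l) (by linarith) (u₁ := u₁) (u₂ := u₂) hzx hz'x

/-- **The probability of `j` disjoint open arms across the fixed-aspect annulus is `≤ 3^{-α j}`**
(BK inequality `real_disjointOccurrencePow_le_pow` and the RSW annulus bound `real_triArm_le`,
with the exponent `α` of `tri_annulusCrossing_bound_holds`), for `0 < δ ≤ ε/16000`.
[cite: AizenmanBurchardDuke1999, Appendix A] -/
theorem real_disjointOccurrencePow_triArm_le {α : ℝ} (hα : 0 < α)
    (hb : ∀ (c : Bool) (δ : ℝ) (z : ℂ) (r₁ r₂ : ℝ), 0 < δ → 1000 * δ ≤ r₁ → 2 * r₁ ≤ r₂ →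
      (triSitePercolation half).real (triAnnulusCrossing c δ z r₁ r₂) ≤ (r₁ / r₂) ^ α)
    {δ ε : ℝ} (hδ : 0 < δ) (hε : 0 < ε) (hδε : δ ≤ ε / 16000) (x : ℂ) (j : ℕ) :
    (triSitePercolation half).real (disjointOccurrencePow (triArm δ x (ε / 16 + 9 * δ) (ε / 4 - 9 * δ)) j) ≤
      ((1 / 3 : ℝ) ^ α) ^ j := by
  obtain ⟨F, hF⟩ := exists_finset_determinedBy_triArm hδ x (ε / 16 + 9 * δ) (ε / 4 - 9 * δ)
  rw [triSitePercolation_eq]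
  refine (real_disjointOccurrencePow_le_pow half hF (isUpperSet_triArm δ x _ _) j).trans ?_
  rw [← triSitePercolation_eq]
  have h1 : (triSitePercolation half).real (triArm δ x (ε / 16 + 9 * δ) (ε / 4 - 9 * δ)) ≤
      ((ε / 16 + 9 * δ + δ) / (ε / 4 - 9 * δ - δ)) ^ α :=
    real_triArm_le hb hδ x (by linarith) (by linarith)
  have hden : 0 < ε / 4 - 9 * δ - δ := by linarith
  have hratio : (ε / 16 + 9 * δ + δ) / (ε / 4 - 9 * δ - δ) ≤ 1 / 3 := by
    rw [div_le_div_iff₀ hden (by norm_num)]; linarith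
  have h2 : ((ε / 16 + 9 * δ + δ) / (ε / 4 - 9 * δ - δ)) ^ α ≤ (1 / 3 : ℝ) ^ α :=
    Real.rpow_le_rpow (by positivity) hratio hα.le
  exact pow_le_pow_left₀ measureReal_nonneg (h1.trans h2) j

/-! ### From the loop collection to the lattice event -/

section Collection

variable (D : JordanDomain)

/-- **Generators near a robust witness.** If the loop collection at mesh `δ` has a two-level
separated family of size `k` above `ε` (levels `(ε, η)`), then there are `k` interface loops of
the restricted configuration whose polygon traces have diameter `> ε` and are pairwise distinct
(generators of the closure within `η/8` of the members, `sep_of_near`). [folklore] -/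
theorem exists_loops_of_hasSeparatedTraces₂ {δ : ℝ} {ω : SiteConfig (Site 2)} {k : ℕ} {ε η : ℝ}
    (hη : 0 < η) (h : LoopSpace.HasSeparatedTraces₂ k ε η (triLoopCollection D δ ω)) :
    ∃ (f : Fin k → HexVertex) (w : ∀ l, hexGraph.Walk (f l) (f l)),
      (∀ l, IsSiteInterfaceLoop (ω ∩ triMeshVertices D.carrier δ) (w l)) ∧
      (∀ l l', l ≠ l' → polyTrace δ (w l) ≠ polyTrace δ (w l')) ∧
      ∀ l, ε < diam (polyTrace δ (w l)) := by
  obtain ⟨c, hc, hd, hs⟩ := h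
  have hnear : ∀ i, ∃ g, (∃ (F : HexVertex) (γ : hexGraph.Walk F F),
      IsSiteInterfaceLoop (ω ∩ triMeshVertices D.carrier δ) γ ∧ g = siteLoopCurve δ γ) ∧ dist (c i) g < η / 8 := by
    intro i
    have hci : c i ∈ closure {g : CurveClass ℂ | ∃ (F : HexVertex) (γ : hexGraph.Walk F F),
        IsSiteInterfaceLoop (ω ∩ triMeshVertices D.carrier δ) γ ∧ g = siteLoopCurve δ γ} := by
      have := hc i
      rwa [triLoopCollection, TopologicalSpace.Closeds.mem_closure] at this
    obtain ⟨g, hg, hdg⟩ := Metric.mem_closure_iff.1 hci (η / 8) (by positivity)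
    exact ⟨g, hg, hdg⟩
  choose g hg hdist using hnear
  choose F γ hγ hgeq using hg
  obtain ⟨hd', hs'⟩ := LoopSpace.sep_of_near hd hs hdist
  have hrange : ∀ i, (g i).range = polyTrace δ (γ i) := fun i ↦ by
    rw [hgeq i, siteLoopCurve, CurveClass.range_mk]
    exact range_toCurve_eq_polyTrace (by have := (hγ i).three_le_length; omega)
  refine ⟨F, γ, hγ, fun l l' hll' heq ↦ ?_, fun l ↦ ?_⟩
  · have := hs' l l' hll'
    rw [hrange, hrange, heq, hausdorffDist_self_zero] at this
    linarith
  · have := hd' l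
    rw [hrange] at this
    linarith

/-- **The lattice event behind "too many large traces".** Let `Xs` be a finite set of centres
whose `ε/16`-balls cover `cthickening 1 D`, `0 < δ ≤ min 1 (3ε/640)`. If the loop collection at
mesh `δ` is not in `FewLargeTraces N ε` with `#Xs · (2j + 1) < N + 1`, then for some centre
`x ∈ Xs`, `ω` has `j` disjoint open arms across `A(x; ε/16 + 9δ, ε/4 - 9δ)` (pigeonhole on the
balls met by the `N + 1` distinct large traces, then `mem_disjointOccurrencePow_of_distinct_loops`
for the restricted configuration and monotonicity of the increasing event). [cite: CamiaNewman2006, Thm 2] -/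
theorem exists_mem_disjointOccurrencePow_of_not_fewLargeTraces {ε : ℝ} (hε : 0 < ε) {Xs : Finset ℂ}
    (hcover : cthickening 1 D.carrier ⊆ ⋃ x ∈ Xs, ball x (ε / 16)) {δ : ℝ} (hδ : 0 < δ) (hδ1 : δ ≤ 1)
    (hδε : δ ≤ 3 * ε / 640) {N j : ℕ} (hN : Xs.card * (2 * j + 1) < N + 1) {ω : SiteConfig (Site 2)}
    (h : ¬ LoopSpace.FewLargeTraces N ε (triLoopCollection D δ ω)) :
    ∃ x ∈ Xs, ω ∈ disjointOccurrencePow (triArm δ x (ε / 16 + 9 * δ) (ε / 4 - 9 * δ)) j := by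
  classical
  obtain ⟨η, hη, hsep⟩ := LoopSpace.not_fewLargeTraces_iff.1 h
  obtain ⟨F, γ, hγ, hne, hdiam⟩ := exists_loops_of_hasSeparatedTraces₂ D hη hsep
  -- each trace meets some covering ball
  have hball : ∀ i : Fin (N + 1), ∃ x ∈ Xs, ∃ z ∈ polyTrace δ (γ i), dist z x < ε / 16 := by
    intro i
    have hlen : 0 < (γ i).length := by have := (hγ i).three_le_length; omega
    have hz : polyPt δ (γ i) 0 ∈ polyTrace δ (γ i) := polyPiece_subset_polyTrace hlen (left_mem_segment _ _ _)
    have hrange : CurveClass.range (siteLoopCurve δ (γ i)) = polyTrace δ (γ i) := by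
      rw [siteLoopCurve, CurveClass.range_mk]; exact range_toCurve_eq_polyTrace hlen
    have hz' : polyPt δ (γ i) 0 ∈ CurveClass.range (siteLoopCurve δ (γ i)) := by rw [hrange]; exact hz
    have hzD : polyPt δ (γ i) 0 ∈ cthickening 1 D.carrier :=
      cthickening_mono hδ1 _ (range_subset_cthickening_of_mem_triLoopCollection_holds (D := D) hδ
        (siteLoopCurve_mem_triLoopCollection (hγ i)) hz')
    obtain ⟨x, hx, hzx⟩ := mem_iUnion₂.1 (hcover hzD)
    exact ⟨x, hx, _, hz, mem_ball.1 hzx⟩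
  choose φ hφ hzφ using hball
  obtain ⟨x, hx, hcard⟩ := Finset.exists_lt_card_fiber_of_mul_lt_card_of_maps_to
    (t := Xs) (f := φ) (n := 2 * j + 1) (fun i _ ↦ hφ i) (by rw [Finset.card_univ, Fintype.card_fin]; exact hN)
  -- `2j + 2` loops in the fibre of `x`
  set S := Finset.univ.filter fun i : Fin (N + 1) ↦ φ i = x with hS
  obtain ⟨S', hS'S, hS'card⟩ := Finset.exists_subset_card_eq (show 2 * j + 2 ≤ S.card by omega)
  set e := (S'.equivFinOfCardEq hS'card).symm with he
  have heS : ∀ l, φ (e l) = x := fun l ↦ (Finset.mem_filter.1 (hS'S (e l).2)).2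
  refine ⟨x, hx, ?_⟩
  have hω' := mem_disjointOccurrencePow_of_distinct_loops (x := x) (j := j) hδ hε hδε
    (f := fun l ↦ F (e l)) (w := fun l ↦ γ (e l)) (fun l ↦ hγ (e l))
    (fun l l' hll' ↦ hne _ _ fun heq ↦ hll' (e.injective (Subtype.ext heq)))
    (fun l ↦ hdiam (e l))
    (fun l ↦ by obtain ⟨z, hz, hzx⟩ := hzφ (e l); exact ⟨z, hz, by rw [← heS l]; exact hzx.le⟩)
  exact (isUpperSet_triArm δ x _ _).disjointOccurrencePow j inter_subset_left hω'

/-- **Uniform bound before the limit**: with `Xs` as above and `α` the RSW exponent, for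
`0 < δ ≤ min 1 (ε/16000)` and `#Xs (2j + 1) < N + 1`,
`P(L_δ ∉ FewLargeTraces N ε) ≤ #Xs · 3^{-α j}`. [cite: CamiaNewman2006, Thm 2] -/
theorem measure_not_fewLargeTraces_le {α : ℝ} (hα : 0 < α)
    (hb : ∀ (c : Bool) (δ : ℝ) (z : ℂ) (r₁ r₂ : ℝ), 0 < δ → 1000 * δ ≤ r₁ → 2 * r₁ ≤ r₂ →
      (triSitePercolation half).real (triAnnulusCrossing c δ z r₁ r₂) ≤ (r₁ / r₂) ^ α)
    {ε : ℝ} (hε : 0 < ε) {Xs : Finset ℂ} (hcover : cthickening 1 D.carrier ⊆ ⋃ x ∈ Xs, ball x (ε / 16))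
    {δ : ℝ} (hδ : 0 < δ) (hδ1 : δ ≤ 1) (hδε : δ ≤ ε / 16000) {N j : ℕ} (hN : Xs.card * (2 * j + 1) < N + 1) :
    triSitePercolation half {ω | ¬ LoopSpace.FewLargeTraces N ε (triLoopCollection D δ ω)} ≤
      ENNReal.ofReal (Xs.card * ((1 / 3 : ℝ) ^ α) ^ j) := by
  classical
  have hsub : {ω | ¬ LoopSpace.FewLargeTraces N ε (triLoopCollection D δ ω)} ⊆
      ⋃ x ∈ Xs, disjointOccurrencePow (triArm δ x (ε / 16 + 9 * δ) (ε / 4 - 9 * δ)) j := fun ω hω ↦ by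
    obtain ⟨x, hx, hωx⟩ := exists_mem_disjointOccurrencePow_of_not_fewLargeTraces D hε hcover hδ hδ1
      (by linarith) hN hω
    exact mem_iUnion₂.2 ⟨x, hx, hωx⟩
  calc triSitePercolation half {ω | ¬ LoopSpace.FewLargeTraces N ε (triLoopCollection D δ ω)}
      ≤ triSitePercolation half (⋃ x ∈ Xs, disjointOccurrencePow (triArm δ x (ε / 16 + 9 * δ) (ε / 4 - 9 * δ)) j) :=
        measure_mono hsub
    _ = ENNReal.ofReal ((triSitePercolation half).real
          (⋃ x ∈ Xs, disjointOccurrencePow (triArm δ x (ε / 16 + 9 * δ) (ε / 4 - 9 * δ)) j)) :=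
        (ofReal_measureReal (measure_ne_top _ _)).symm
    _ ≤ ENNReal.ofReal (∑ x ∈ Xs, (triSitePercolation half).real
          (disjointOccurrencePow (triArm δ x (ε / 16 + 9 * δ) (ε / 4 - 9 * δ)) j)) :=
        ENNReal.ofReal_le_ofReal (measureReal_biUnion_finset_le _ _)
    _ ≤ ENNReal.ofReal (∑ _x ∈ Xs, ((1 / 3 : ℝ) ^ α) ^ j) :=
        ENNReal.ofReal_le_ofReal (Finset.sum_le_sum fun x _ ↦ real_disjointOccurrencePow_triArm_le hα hb hδ hε hδε x j)
    _ = ENNReal.ofReal (Xs.card * ((1 / 3 : ℝ) ^ α) ^ j) := by rw [Finset.sum_const, nsmul_eq_mul]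

/-! ### The limit -/

/-- **Almost surely under every subsequential limit, for each `ε > 0` some `FewLargeTraces N ε`
holds.** [cite: CamiaNewman2006, Thm 2] -/
theorem ae_exists_fewLargeTraces_of_tendsto {l : Filter ℝ} [l.NeBot] (hl : l ≤ 𝓝[>] 0)
    {P' : ProbabilityMeasure (LoopSpace ℂ)} (hlim : Tendsto (triLoopLaw D) l (𝓝 P')) {ε : ℝ} (hε : 0 < ε) :
    ∀ᵐ L ∂(P' : Measure (LoopSpace ℂ)), ∃ N : ℕ, LoopSpace.FewLargeTraces N ε L := by
  classical
  obtain ⟨α, hα, hb⟩ := tri_annulusCrossing_bound_holds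
  -- the covering
  have hK : IsCompact (cthickening 1 D.carrier) := D.isBounded.cthickening.isCompact_closure |>.of_isClosed_subset
    isClosed_cthickening (by rw [closure_eq_iff_isClosed.2 isClosed_cthickening])
  obtain ⟨Xs₀, -, hXfin, hcover₀⟩ := finite_cover_balls_of_compact hK (show (0 : ℝ) < ε / 16 by positivity)
  set Xs : Finset ℂ := hXfin.toFinset with hXs
  have hcover : cthickening 1 D.carrier ⊆ ⋃ x ∈ Xs, ball x (ε / 16) := by
    intro z hz
    obtain ⟨x, hx, hzx⟩ := mem_iUnion₂.1 (hcover₀ hz)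
    exact mem_iUnion₂.2 ⟨x, hXfin.mem_toFinset.2 hx, hzx⟩
  set θ : ℝ := (1 / 3 : ℝ) ^ α with hθ
  have hθ0 : 0 ≤ θ := by positivity
  have hθ1 : θ < 1 := Real.rpow_lt_one (by norm_num) (by norm_num) hα
  -- the exceptional set has measure `≤ #Xs θ^j` for every `j`
  have hbound : ∀ j : ℕ, (P' : Measure (LoopSpace ℂ)) {L | ¬ ∃ N : ℕ, LoopSpace.FewLargeTraces N ε L} ≤
      ENNReal.ofReal (Xs.card * θ ^ j) := by
    intro j
    set N : ℕ := Xs.card * (2 * j + 1) with hN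
    have hNlt : Xs.card * (2 * j + 1) < N + 1 := by omega
    set Fc : Set (LoopSpace ℂ) := {L | LoopSpace.FewLargeTraces N ε L} with hFc
    have hFle : ENNReal.ofReal (1 - Xs.card * θ ^ j) ≤ (P' : Measure (LoopSpace ℂ)) Fc := by
      refine le_measure_of_isClosed_of_tendsto hl hlim (LoopSpace.isClosed_setOf_fewLargeTraces N ε) ?_
      filter_upwards [Ioc_mem_nhdsGT (show (0 : ℝ) < min 1 (ε / 16000) by positivity)] with δ hδ
      have hδ1 : δ ≤ 1 := hδ.2.trans (min_le_left _ _)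
      have hδε : δ ≤ ε / 16000 := hδ.2.trans (min_le_right _ _)
      have hc := measure_not_fewLargeTraces_le D hα hb hε hcover hδ.1 hδ1 hδε hNlt
      rw [show {ω | LoopSpace.FewLargeTraces N ε (triLoopCollection D δ ω)} =
        {ω | ¬ LoopSpace.FewLargeTraces N ε (triLoopCollection D δ ω)}ᶜ from by ext ω; simp]
      have hmeas : NullMeasurableSet {ω | ¬ LoopSpace.FewLargeTraces N ε (triLoopCollection D δ ω)} (triSitePercolation half) := by
        have : {ω | ¬ LoopSpace.FewLargeTraces N ε (triLoopCollection D δ ω)} = (triLoopCollection D δ) ⁻¹' Fcᶜ := by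
          ext ω; simp [hFc]
        rw [this]
        exact ((measurable_triLoopCollection_holds D hδ.1) (LoopSpace.isClosed_setOf_fewLargeTraces N ε).measurableSet.compl).nullMeasurableSet
      rw [prob_compl_eq_one_sub₀ hmeas]
      rw [ENNReal.ofReal_sub _ (by positivity), ENNReal.ofReal_one]
      exact tsub_le_tsub_left hc 1
    have hEsub : {L : LoopSpace ℂ | ¬ ∃ N : ℕ, LoopSpace.FewLargeTraces N ε L} ⊆ Fcᶜ :=
      fun L hL hLF ↦ hL ⟨N, hLF⟩
    calc (P' : Measure (LoopSpace ℂ)) {L | ¬ ∃ N : ℕ, LoopSpace.FewLargeTraces N ε L}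
        ≤ (P' : Measure (LoopSpace ℂ)) Fcᶜ := measure_mono hEsub
      _ = 1 - (P' : Measure (LoopSpace ℂ)) Fc :=
          prob_compl_eq_one_sub (LoopSpace.isClosed_setOf_fewLargeTraces N ε).measurableSet
      _ ≤ 1 - ENNReal.ofReal (1 - Xs.card * θ ^ j) := tsub_le_tsub_left hFle 1
      _ ≤ ENNReal.ofReal (Xs.card * θ ^ j) := one_sub_ofReal_one_sub_le _
  have h0 : (P' : Measure (LoopSpace ℂ)) {L | ¬ ∃ N : ℕ, LoopSpace.FewLargeTraces N ε L} = 0 := by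
    refine le_antisymm ?_ bot_le
    have ht : Tendsto (fun j : ℕ ↦ ENNReal.ofReal (Xs.card * θ ^ j)) atTop (𝓝 0) := by
      rw [show (0 : ℝ≥0∞) = ENNReal.ofReal (Xs.card * 0) by simp]
      exact ENNReal.tendsto_ofReal ((tendsto_pow_atTop_nhds_zero_of_lt_one hθ0 hθ1).const_mul _)
    exact le_of_tendsto_of_tendsto' tendsto_const_nhds ht hbound
  rw [ae_iff]
  exact h0

/-- **Scaling limits of the loop collections are locally finite** (the field
`IsCNLFamily.ae_finite_traces` for any subsequential limit law; Camia–Newman, CMP 268 (2006),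
Thm 2 (ii)): `P'`-almost surely, for every `ε > 0` only finitely many distinct traces of members
have diameter `> ε`. [cite: CamiaNewman2006, Thm 2] -/
theorem ae_finite_traces_of_tendsto {l : Filter ℝ} [l.NeBot] (hl : l ≤ 𝓝[>] 0)
    {P' : ProbabilityMeasure (LoopSpace ℂ)} (hlim : Tendsto (triLoopLaw D) l (𝓝 P')) :
    ∀ᵐ L ∂(P' : Measure (LoopSpace ℂ)), ∀ ε : ℝ, 0 < ε →
      {s : Set ℂ | ∃ c ∈ L, CurveClass.range c = s ∧ ε < diam s}.Finite := by
  have hall : ∀ᵐ L ∂(P' : Measure (LoopSpace ℂ)), ∀ n : ℕ, ∃ N : ℕ, LoopSpace.FewLargeTraces N (1 / (n + 1 : ℝ)) L :=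
    ae_all_iff.2 fun n ↦ ae_exists_fewLargeTraces_of_tendsto D hl hlim (by positivity)
  filter_upwards [hall] with L hL ε hε
  obtain ⟨n, hn⟩ := exists_nat_one_div_lt hε
  obtain ⟨N, hN⟩ := hL n
  exact LoopSpace.finite_traces_mono hn.le hN.finite

/-- The same for a cluster point of the laws along `𝓝[>] 0`. [cite: CamiaNewman2006, Thm 2] -/
theorem ae_finite_traces_of_mapClusterPt {P' : ProbabilityMeasure (LoopSpace ℂ)}
    (h : MapClusterPt P' (𝓝[>] (0 : ℝ)) (triLoopLaw D)) :
    ∀ᵐ L ∂(P' : Measure (LoopSpace ℂ)), ∀ ε : ℝ, 0 < ε →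
      {s : Set ℂ | ∃ c ∈ L, CurveClass.range c = s ∧ ε < diam s}.Finite := by
  obtain ⟨l, hne, hl, ht⟩ := h.exists_tendsto_of_le
  haveI := hne
  exact ae_finite_traces_of_tendsto D hl ht

/-- **`TendstoLaw` form** (the field `IsCNLFamily.ae_finite_traces` for every limit in law of the
loop collections; Camia–Newman, CMP 268 (2006), Thm 2 (ii)). [cite: CamiaNewman2006, Thm 2] -/
theorem ae_finite_traces_of_tendstoLaw {P' : Measure (LoopSpace ℂ)} [IsProbabilityMeasure P']
    (h : TendstoLaw (Ωδ := fun _ ↦ SiteConfig (Site 2)) (fun δ ↦ triLoopCollection D δ)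
      (fun _ ↦ triSitePercolation half) id P') :
    ∀ᵐ L ∂P', ∀ ε : ℝ, 0 < ε → {s : Set ℂ | ∃ c ∈ L, CurveClass.range c = s ∧ ε < diam s}.Finite := by
  have h' := (tendstoLaw_iff_tendsto_triLoopLaw D).1 h
  exact ae_finite_traces_of_tendsto D le_rfl h'

/-- **Reduction of `exists_isCNLFamily_tendsto` to the existence of the limit laws and their
conformal invariance.** Every `IsCNLFamily` field other than conformal invariance — the loop
property, traces in `D̄`, reroot-saturation, local finiteness of traces (this file) and infinitude
of non-trivial traces (`CLE6InfiniteTraces.lean`) — holds for every limit law of the percolation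
loop collections; what remains is the full scaling limit itself and its conformal invariance
(Camia–Newman, MSRI 55 (2008), Thms 2–3 and Comm. Math. Phys. 268 (2006), Thms 2, 6).
[cite: CamiaNewman2008, Theorems 2–3] -/
theorem exists_isCNLFamily_tendsto_of_tendstoLaw''' (ν : JordanDomain → Measure (LoopSpace ℂ))
    (hP : ∀ D, IsProbabilityMeasure (ν D))
    (hlim : ∀ D : JordanDomain, TendstoLaw (Ωδ := fun _ ↦ SiteConfig (Site 2))
      (fun δ ↦ triLoopCollection D δ) (fun _ ↦ triSitePercolation half) id (ν D))
    (hconf : ∀ (D D' : JordanDomain) (φ : ConformalEquiv D.carrier D'.carrier) (Φ : C(ℂ, ℂ)),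
      EqOn Φ φ D.carrier → MapsTo Φ (closure D.carrier) (closure D'.carrier) →
        ν D' = (ν D).map (LoopSpace.map Φ)) :
    exists_isCNLFamily_tendsto :=
  exists_isCNLFamily_tendsto_of_tendstoLaw'' ν hP hlim
    (fun D ↦ by haveI := hP D; exact ae_finite_traces_of_tendstoLaw D (hlim D)) hconf

end Collection

end Literature.Probability.Percolation
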